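import Summits.HodgeConjecture.HodgeCM.StubTree.ThetaSpanFromBMM_3

/-! PORT of `HodgeCM/StubTree/ThetaSpanFromBMM.lean` (HodgeCMPerL run 82) — part 4: continuation of `Summits.HodgeConjecture.HodgeCM.StubTree.ThetaSpanFromBMM_3` (split at a top-level declaration boundary by port_pkg.py; scope re-opened below; declarations unchanged). -/

-- port_pkg: scope re-opened for this part (file-level context, then the namespace/section stack open at the cut)
set_option autoImplicit false
noncomputable section
open scoped Matrix
open NumberField NumberField.InfinitePlace
namespace HodgeCM
open Literature.AlgebraicGeometry.Motives (CMType)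
open Literature.AlgebraicGeometry.ShimuraVarieties (conjRingHomK embedding_conjRingHomK)
namespace Universe
variable {U : Universe}
variable (U)
variable {U} {Hk : U.HeckeData} {T : U.ThetaModel}
variable (U)
/-- **COR-CM — the lineage's FULLY DISCHARGED END STATE (generation 7, Part D).**  `HC_CM` from: the model facts
`M`; (V) `Fact_virtualCup11₂` (PRINT); (S) `LiuSupplyFace` (PRINT ∧ `Dict`); the five ISOLATION inputs of the theta
model with `Fact_innerEmb`, `Fact_hodgeRiemann20`; the DESIGN facts `Design_kappaConj`, `Design_frameSignConj`; the
PRINT-INTERFACE datum package `IsoEmbFace Hk T`; the BMM–glue package `BMMGlueFace T` (every conjunct P / P-IF /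
MODEL / DESIGN); Pohlmann; [QW8]+Milne.  Neither (TS) nor (CG) — generation 6's residual — is a hypothesis. -/
theorem COR_CM_of_liu_bmmGlue (M : U.ModelAxioms) (hV : U.Fact_virtualCup11₂) (hL : U.LiuSupplyFace)
    {T : U.ThetaModel} (h₂ : T.Fact_innerEmb) (h₅ : T.Open_thetaSub) (h₇ : T.Open_thetaGen12)
    (h₈ : T.Open_thetaReal34) (h₉ : T.Open_chars) (h₁₀ : T.Open_occ) (hHR : U.Fact_hodgeRiemann20)
    (hκ : T.Design_kappaConj) (hs : T.Design_frameSignConj)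
    {Hk : U.HeckeData} (hD : U.IsoEmbFace Hk T) (hX : U.BMMGlueFace T)
    (hPo : U.PohlmannSpan) (hQ : U.Qw8Sufficiency) : U.HC_CM :=
  COR_CM_of_liu_thetaSpan U M hV hL h₂ h₅ h₇ h₈ h₉ h₁₀ hHR hD (thetaSpanFace_of_bmmGlue M.pull_hodge hκ hs h₅ hX)
    hPo hQ

/-- **PerL v5 Thm 4.4 — fully discharged end state.** -/
theorem perL44_of_liu_bmmGlue (M : U.ModelAxioms) (hV : U.Fact_virtualCup11₂) (hL : U.LiuSupplyPerL)
    {T : U.ThetaModel} (h₂ : T.Fact_innerEmb) (h₅ : T.Open_thetaSub) (h₇ : T.Open_thetaGen12)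
    (h₈ : T.Open_thetaReal34) (h₉ : T.Open_chars) (h₁₀ : T.Open_occ) (hHR : U.Fact_hodgeRiemann20)
    (hκ : T.Design_kappaConj) (hs : T.Design_frameSignConj)
    {Hk : U.HeckeData} (hD : U.IsoEmbPerL Hk T) (hX : U.BMMGluePerL T) : U.PerL44 :=
  perL44_of_liu_thetaSpan U M hV hL h₂ h₅ h₇ h₈ h₉ h₁₀ hHR hD (thetaSpanPerL_of_bmmGlue M.pull_hodge hκ hs h₅ hX)

/-- **PerL (`W_per^L`) — fully discharged end state.** -/
theorem perL_of_liu_bmmGlue (M : U.ModelAxioms) (hV : U.Fact_virtualCup11₂) (hL : U.LiuSupplyPerL)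
    {T : U.ThetaModel} (h₂ : T.Fact_innerEmb) (h₅ : T.Open_thetaSub) (h₇ : T.Open_thetaGen12)
    (h₈ : T.Open_thetaReal34) (h₉ : T.Open_chars) (h₁₀ : T.Open_occ) (hHR : U.Fact_hodgeRiemann20)
    (hκ : T.Design_kappaConj) (hs : T.Design_frameSignConj)
    {Hk : U.HeckeData} (hD : U.IsoEmbPerL Hk T) (hX : U.BMMGluePerL T) : U.PerL :=
  perL_of_liu_thetaSpan U M hV hL h₂ h₅ h₇ h₈ h₉ h₁₀ hHR hD (thetaSpanPerL_of_bmmGlue M.pull_hodge hκ hs h₅ hX)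

end Universe

end HodgeCM

end
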